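import Summits.BirchSwinnertonDyer.BirchSwinnertonDyer.Theorems.KatoDescentPotSupersingularCartanMuRoadDoors
import Summits.BirchSwinnertonDyer.BirchSwinnertonDyer.Theorems.AdditiveBranchIMCGordTwoRankOneSmallImageDickson
import Summits.BirchSwinnertonDyer.Rank1Residual.X11a.Cells
import Literature.NumberTheory.EllipticCurves.Rank1Residual.MuLambdaCarriers
import Literature.NumberTheory.EllipticCurves.Rank1Residual.FirstLayerCertificates
import HarnessLib

/-!
# Route `PrintX11a`, child crux U3 = `PrintX11a.UpperNonSurjThree` (item stmt-BirchSwinnertonDyer-20613),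
# line «finemu3» (skeleton sha16 4137ae9383b0650b), stub `FineMu.stub_conjA_three` — the PER-PAIR ENTRY of the
# (A)-road on the U3 domain BY NAME: Coates–Sujatha's statement (A) at a small-image pair from TWO class-group
# integers of `ℚ(E[p])`, with every structural binder discharged from `ClassX11a W p ∧ ¬ Surj W p`
# (cell `bsd-print-x11a`, width seat `bsd-line-x11a-p1-w2`; `--supports` 20613; closes nothing)

HONEST FRAMING.  BSD is not proved by any of this; nothing is asserted about any curve; the crux and its
load-bearing stub `stub_conjA_three` (statement (A) CLASS-WIDE on U3 = an instance of Iwasawa's classical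
`μ = 0` conjecture for the non-abelian fields `ℚ(E[3])`, line card (P1)) stay OPEN.  THEOREMS ONLY: no
definition, no named fact minted, no `sorry`; every theorem is CONDITIONAL on the displayed printed facts
(Fukuda 1994 Thm. 1 `hF1`/`hF2`, Iwasawa 1956 `hIw`, Coates–Sujatha 2005 Thm. 3.4 `hCS`), exactly as the
class-free doors it composes.

WHAT.  The line card of «finemu3» (Lines/finemu3.md, (P1)/(P2)) makes `stub_conjA_three` a PAIR-BY-PAIR /
congruence-family closer: per pair, statement (A) for `E` at `p` follows from Coates–Sujatha Thm. 3.4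
(`μ(L_cyc/L) = 0`, `L = ℚ(E[p])` ⟹ (A)) and `μ(L_cyc/L) = 0` from class-group numerics of the cyclotomic
`ℤ_p`-tower of `L` (Fukuda 1994 Thm. 1: two consecutive layers `n ≥ n₀` with the same `ord_p h` resp. the same
`p`-rank; Iwasawa 1956).  The tree's CLASS-FREE doors `CartanMuRoadDoors.conjA_of_classNumberPExp_succ_eq` /
`conjA_of_classGroupPRank_succ_eq` (cell bsd-potss, on top of bsd-print-x8's proof that Fukuda's index is
`n₀ = 0` whenever `p ∤ #Gal(ℚ(E[p])/ℚ)`) carry ONE structural hypothesis that is not a certificate integer: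
`hd : p ∤ #Gal(ℚ(E[p])/ℚ)`.  On the finemu3 domain it is AUTOMATIC: `E[p]` irreducible and `ρ̄_{E,p}` not onto
force `p ∤ #Gal(ℚ(E[p])/ℚ)` (Serre 1972 §2.4 Prop. 15 with `det ρ̄ = χ̄_p` onto — the tree THEOREM
`SmallImageDickson.not_dvd_card_aut_divisionField`, cell bsd-addord, proved, no cite input).  This file composes
the two (different cells, different routes) into the doors a U3 record applies in one line:

* §1 (class-free, any odd `p`): `conjAAt_of_irr_of_not_surj_of_classNumberPExp_succ_eq`,
  `conjAAt_of_irr_of_not_surj_of_classGroupPRank_succ_eq` — `Irr ∧ ¬Surj ∧ p ≠ 2` + two integers ⟹ `ConjAAt W p`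
  (the tree carrier `Rank1Residual.ConjAAt`, verbatim the conclusion of `stub_conjA_three` at the pair);
* §2 (the U3/U5 domain of route PrintX11a): `ClassX11a.conjAAt_of_not_surj_of_classNumberPExp_succ_eq`,
  `ClassX11a.conjAAt_of_not_surj_of_classGroupPRank_succ_eq` (`p ≠ 2` and `Irr` read off `ClassX11a`), and the
  Iwasawa-1956 door `ClassX11a.conjAAt_of_not_surj_of_not_dvd_classNumber_of_unique_prime` for completeness;
* §3 (the class form, for the line's bookkeeping): `FineMu.conjA_three_of_classicalMu` — the registered stub
  `stub_conjA_three` VERBATIM follows from «classical `μ₃ = 0` for every cyclotomic `ℤ₃`-extension of `ℚ(E[3])`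
  at every U3 pair» and Coates–Sujatha Thm. 3.4; i.e. the line's open input is exactly an instance of Iwasawa's
  `μ`-conjecture (open for these `D₄`/`SD₁₆` fields: no Ferrero–Washington over a non-abelian `ℚ(E[3])`).

Consumers: the finemu3 certificate screen of the cell's typer seat ty3 g5 (class groups of `ℚ(E[3])` and of its
first cyclotomic layer for the 12 known U3 pairs / their `E[3]`-congruence families, STATUS 2026-08-28T04:53:40Z)
books a pair through §2 displaying integers only; the transfer stub `stub_multDivisibilityAt_of_conjA` (seat
x11a-p2) then turns `ConjAAt W 3` into `X11b.MultDivisibilityAt W 3` and the landed door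
`X11b.missingUpperBoundAt_of_classX11a_of_multDivisibilityAt` into `ord₃ #Ш ≤ ord₃ #Ш_an` at the pair.

References: [Fukuda1994] Thm. 1 (1), (2), p. 264; [CoatesSujatha2005] §3 statement (A), Thm. 3.4;
[Greenberg2001IwasawaPastPresent] Prop. 2.1 p. 339 (Iwasawa 1956); [Serre1972] §2.4 Prop. 15, §5.4;
[DeoRaySujatha2023] §5 Lemma 5.1 (tameness from the image); [Washington1997] §13.1, Prop. 13.2.
-/

set_option linter.dupNamespace false
set_option autoImplicit false

noncomputable section

open scoped Classical

open WeierstrassCurve Field IsDedekindDomain NumberField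
  Literature.NumberTheory.EllipticCurves
  Literature.NumberTheory.EllipticCurves.Rank1Residual
  Literature.NumberTheory.IwasawaTheory
  Summit.BirchSwinnertonDyer.Rank1Residual
  Summit.BirchSwinnertonDyer.BirchSwinnertonDyer.Theorems.CartanMuRoadDoors
  Summit.BirchSwinnertonDyer.BirchSwinnertonDyer.Theorems.AdditiveBranchIMCGordTwoRankOne.SmallImageDickson

namespace Summit.BirchSwinnertonDyer.BirchSwinnertonDyer.Theorems.UpperNonSurjThreeConjADoors

/-! ### §1 Class-free doors: small image (`Irr ∧ ¬Surj`) at an odd prime + two class-group integers ⟹ (A) -/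

section ClassFree

variable (W : WeierstrassCurve ℚ) [W.IsElliptic] (p : ℕ) [Fact p.Prime]

/-- **(A) at a small-image pair from Fukuda's class-number-ORDER certificate.**  Granted Fukuda 1994 Thm. 1 (1)
(`hF1`) and Coates–Sujatha 2005 Thm. 3.4 (`hCS`): for `E/ℚ` and an odd prime `p` with `E[p]` irreducible and
`ρ̄_{E,p}` NOT surjective, if every cyclotomic `ℤ_p`-extension of `L = ℚ(E[p])` has two consecutive layers
`L_n ⊂ L_{n+1}` with `ord_p h(L_{n+1}) = ord_p h(L_n)`, then Coates–Sujatha's statement (A) holds for `E` at `p`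
(`Rank1Residual.ConjAAt W p`).  The structural binder `p ∤ #Gal(ℚ(E[p])/ℚ)` of the class-free door
`CartanMuRoadDoors.conjA_of_classNumberPExp_succ_eq` is DISCHARGED by Serre's Prop. 15
(`SmallImageDickson.not_dvd_card_aut_divisionField`).  CONDITIONAL on the two facts; (A) asserted for no curve.
[cite: Fukuda1994, Thm. 1 (1), p. 264] [cite: CoatesSujatha2005, Thm. 3.4 (§3)] [cite: Serre1972, §2.4 Prop. 15] -/
theorem conjAAt_of_irr_of_not_surj_of_classNumberPExp_succ_eq
    (hF1 : fukuda1994_thm1_classNumberPExp_const_of_succ_eq)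
    (hCS : CoatesSujatha2005.thm34_fineSelmerDual_moduleFinite_of_classicalMuVanishes_divisionField)
    (hp : p ≠ 2) (hirr : W.HasIrreducibleModPGaloisRep p) (hns : ¬ W.HasSurjectiveModNGaloisRep p) (n : ℕ)
    (hord : haveI : NeZero p := ⟨(Fact.out : p.Prime).ne_zero⟩
      ∀ κL : ZpExtension (W.divisionField p) p, κL.IsCyclotomic →
        classNumberPExp κL (n + 1) = classNumberPExp κL n) :
    ConjAAt W p := by
  haveI : NeZero p := ⟨(Fact.out : p.Prime).ne_zero⟩
  intro κ hκ
  exact conjA_of_classNumberPExp_succ_eq hF1 hCS W p hp (not_dvd_card_aut_divisionField W p hirr hns) n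
    hord κ hκ

/-- **(A) at a small-image pair from Fukuda's `p`-RANK certificate.**  As
`conjAAt_of_irr_of_not_surj_of_classNumberPExp_succ_eq` with Fukuda 1994 Thm. 1 (2) (`hF2`) and the `p`-ranks:
`rank_p Cl(L_{n+1}) = rank_p Cl(L_n)` at two consecutive layers of every cyclotomic `ℤ_p`-extension of
`L = ℚ(E[p])`.  CONDITIONAL on the two facts; (A) asserted for no curve.
[cite: Fukuda1994, Thm. 1 (2), p. 264] [cite: CoatesSujatha2005, Thm. 3.4 (§3)] [cite: Serre1972, §2.4 Prop. 15] -/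
theorem conjAAt_of_irr_of_not_surj_of_classGroupPRank_succ_eq
    (hF2 : fukuda1994_thm1_classGroupPRank_const_of_succ_eq)
    (hCS : CoatesSujatha2005.thm34_fineSelmerDual_moduleFinite_of_classicalMuVanishes_divisionField)
    (hp : p ≠ 2) (hirr : W.HasIrreducibleModPGaloisRep p) (hns : ¬ W.HasSurjectiveModNGaloisRep p) (n : ℕ)
    (hrk : haveI : NeZero p := ⟨(Fact.out : p.Prime).ne_zero⟩
      ∀ κL : ZpExtension (W.divisionField p) p, κL.IsCyclotomic →
        classGroupPRank κL (n + 1) = classGroupPRank κL n) :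
    ConjAAt W p := by
  haveI : NeZero p := ⟨(Fact.out : p.Prime).ne_zero⟩
  intro κ hκ
  exact conjA_of_classGroupPRank_succ_eq hF2 hCS W p hp (not_dvd_card_aut_divisionField W p hirr hns) n
    hrk κ hκ

/-- **Tameness on the small-image locus, in the spelling of the doors' binder**: `E[p]` irreducible and
`ρ̄_{E,p}` not onto ⟹ `p ∤ #Gal(ℚ(E[p])/ℚ)` — the tree theorem `SmallImageDickson.not_dvd_card_aut_divisionField`
re-exported under this file's namespace for record files (it is `Rank1Residual.TameAt W p` unfolded).
[cite: Serre1972, §2.4 Prop. 15] [cite: DeoRaySujatha2023, §5 Lemma 5.1] -/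
theorem tameAt_of_irr_of_not_surj (hirr : W.HasIrreducibleModPGaloisRep p)
    (hns : ¬ W.HasSurjectiveModNGaloisRep p) : TameAt W p := by
  haveI : NeZero p := ⟨(Fact.out : p.Prime).ne_zero⟩
  exact not_dvd_card_aut_divisionField W p hirr hns

end ClassFree

/-! ### §2 On the domain of route `PrintX11a`: `ClassX11a W p ∧ ¬ Surj W p` (U3 at `p = 3`, U5 at `p = 5`) -/

section X11a

variable (W : WeierstrassCurve ℚ) [W.IsElliptic] [W.IsGloballyMinimal] (p : ℕ) [Fact p.Prime]

/-- **U-domain door, ORDER certificate**: at a non-surjective X11a pair (`r_an = 0`, `p ‖ N` odd, `E[p]`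
irreducible, no (ram) witness, `ρ̄_{E,p}` not onto — images 3Ns/3Nn at `p = 3`, 5Ns/5S4 at `p = 5`), two
consecutive layers of every cyclotomic `ℤ_p`-extension of `ℚ(E[p])` with the same `ord_p h` give statement (A) at
the pair, granted Fukuda 1994 Thm. 1 (1) and Coates–Sujatha Thm. 3.4.  Displayed hypotheses: integers only.
CONDITIONAL on the two facts; (A) asserted for no curve. [cite: Fukuda1994, Thm. 1 (1), p. 264]
[cite: CoatesSujatha2005, Thm. 3.4 (§3)] -/
theorem _root_.Summit.BirchSwinnertonDyer.Rank1Residual.ClassX11a.conjAAt_of_not_surj_of_classNumberPExp_succ_eq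
    (hF1 : fukuda1994_thm1_classNumberPExp_const_of_succ_eq)
    (hCS : CoatesSujatha2005.thm34_fineSelmerDual_moduleFinite_of_classicalMuVanishes_divisionField)
    (hX : ClassX11a W p) (hns : ¬ Surj W p) (n : ℕ)
    (hord : haveI : NeZero p := ⟨(Fact.out : p.Prime).ne_zero⟩
      ∀ κL : ZpExtension (W.divisionField p) p, κL.IsCyclotomic →
        classNumberPExp κL (n + 1) = classNumberPExp κL n) :
    ConjAAt W p :=
  conjAAt_of_irr_of_not_surj_of_classNumberPExp_succ_eq W p hF1 hCS hX.ne_two hX.irr hns n hord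

/-- **U-domain door, RANK certificate**: as `ClassX11a.conjAAt_of_not_surj_of_classNumberPExp_succ_eq` with the
`p`-ranks of the class groups of two consecutive layers and Fukuda 1994 Thm. 1 (2).
CONDITIONAL on the two facts; (A) asserted for no curve. [cite: Fukuda1994, Thm. 1 (2), p. 264]
[cite: CoatesSujatha2005, Thm. 3.4 (§3)] -/
theorem _root_.Summit.BirchSwinnertonDyer.Rank1Residual.ClassX11a.conjAAt_of_not_surj_of_classGroupPRank_succ_eq
    (hF2 : fukuda1994_thm1_classGroupPRank_const_of_succ_eq)
    (hCS : CoatesSujatha2005.thm34_fineSelmerDual_moduleFinite_of_classicalMuVanishes_divisionField)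
    (hX : ClassX11a W p) (hns : ¬ Surj W p) (n : ℕ)
    (hrk : haveI : NeZero p := ⟨(Fact.out : p.Prime).ne_zero⟩
      ∀ κL : ZpExtension (W.divisionField p) p, κL.IsCyclotomic →
        classGroupPRank κL (n + 1) = classGroupPRank κL n) :
    ConjAAt W p :=
  conjAAt_of_irr_of_not_surj_of_classGroupPRank_succ_eq W p hF2 hCS hX.ne_two hX.irr hns n hrk

omit [W.IsGloballyMinimal] in
/-- **U-domain door, Iwasawa-1956 certificate** (`p ∤ h(ℚ(E[p]))` and exactly one prime of `ℚ(E[p])` above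
`p`), restated on `ClassX11a` for the recorder (only `p ≠ 2` is read off the class; no `#Gal` binder arises).
Note for the recorder: at `p ‖ N` the decomposition group at `p` has image of order `≤ 4` in
`Gal(ℚ(E[p])/ℚ)` (Tate curve, `E[p]` finite flat), so this door is expected to be void on U3/U5 (several primes
above `p`); it is kept for uniformity with `CartanMuRoadDoors`.  CONDITIONAL; (A) asserted for no curve.
[cite: Greenberg2001IwasawaPastPresent, Prop. 2.1 p. 339] [cite: CoatesSujatha2005, Thm. 3.4 (§3)] -/
theorem _root_.Summit.BirchSwinnertonDyer.Rank1Residual.ClassX11a.conjAAt_of_not_dvd_classNumber_of_unique_prime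
    [W.IsGloballyMinimal]
    (hIw : iwasawa1956_classNumberPExp_eq_zero_of_not_dvd_classNumber_of_unique_prime)
    (hCS : CoatesSujatha2005.thm34_fineSelmerDual_moduleFinite_of_classicalMuVanishes_divisionField)
    (hX : ClassX11a W p)
    (hh : haveI : NeZero p := ⟨(Fact.out : p.Prime).ne_zero⟩
      haveI : NumberField (W.divisionField p) := NumberField.mk
      ¬ p ∣ NumberField.classNumber (W.divisionField p))
    (hv : haveI : NeZero p := ⟨(Fact.out : p.Prime).ne_zero⟩
      haveI : NumberField (W.divisionField p) := NumberField.mk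
      ∃! v : HeightOneSpectrum (𝓞 (W.divisionField p)), ((p : ℕ) : 𝓞 (W.divisionField p)) ∈ v.asIdeal) :
    ConjAAt W p := by
  intro κ hκ
  exact conjA_of_not_dvd_classNumber_of_unique_prime hIw hCS W p hX.ne_two hh hv κ hκ

end X11a

/-! ### §3 The class form: `stub_conjA_three` ⟸ Iwasawa's classical `μ₃ = 0` on the 3-division fields of U3 -/

/-- **The registered stub `FineMu.stub_conjA_three` VERBATIM from the classical `μ`-conjecture on the domain.**
Granted Coates–Sujatha 2005 Thm. 3.4 (`hCS`): if for every U3 pair — `ClassX11a W 3`, `ρ̄_{W,3}` not onto —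
every cyclotomic `ℤ₃`-extension of the `3`-division field `ℚ(W[3])` (a `D₄`- or `SD₁₆`-extension of `ℚ`,
images 3Ns/3Nn) has Iwasawa `μ = 0` (`IwasawaTheory.ClassicalMuVanishes`), then statement (A) holds at every U3
pair, i.e. the conclusion of `Cruxes.UpperNonSurjThree.FineMu.stub_conjA_three` with its exact binders.  This pins
the line's open input: an instance of Iwasawa's `μ`-conjecture for non-abelian number fields (no Ferrero–Washington
available; line card (P1)).  CONDITIONAL on `hCS` and on the displayed `μ = 0` input; nothing asserted.
[cite: CoatesSujatha2005, §3 statement (A) and Thm. 3.4] [cite: Washington1997, §7.5 (Ferrero–Washington) and §13.3 (the `μ`-conjecture)] -/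
theorem conjA_three_of_classicalMu
    (hCS : CoatesSujatha2005.thm34_fineSelmerDual_moduleFinite_of_classicalMuVanishes_divisionField)
    (hμ : ∀ (W : WeierstrassCurve ℚ) [W.IsElliptic] [W.IsGloballyMinimal],
      ClassX11a W 3 → ¬ Surj W 3 →
        haveI : NeZero (3 : ℕ) := ⟨by decide⟩
        ∀ κL : ZpExtension (W.divisionField 3) 3, κL.IsCyclotomic → ClassicalMuVanishes κL) :
    ∀ (W : WeierstrassCurve ℚ) [W.IsElliptic] [W.IsGloballyMinimal] (p : ℕ) [Fact p.Prime],
      ClassX11a W p → ¬ Surj W p → p = 3 → ConjAAt W p := by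
  intro W _ _ p _ hX hns hp3 κ hκ
  subst hp3
  exact hCS W 3 hX.ne_two (hμ W hX hns) κ hκ

/-- **Conversely-shaped bookkeeping: the stub at ONE pair from `μ = 0` of ITS division field** (the per-pair
form of §3, = Coates–Sujatha Thm. 3.4 applied on the class; what a per-congruence-family `μ = 0` theorem would
feed).  CONDITIONAL on `hCS`; nothing asserted. [cite: CoatesSujatha2005, Thm. 3.4 (§3)] -/
theorem _root_.Summit.BirchSwinnertonDyer.Rank1Residual.ClassX11a.conjAAt_of_classicalMuVanishes_divisionField
    (hCS : CoatesSujatha2005.thm34_fineSelmerDual_moduleFinite_of_classicalMuVanishes_divisionField)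
    (W : WeierstrassCurve ℚ) [W.IsElliptic] [W.IsGloballyMinimal] (p : ℕ) [Fact p.Prime]
    (hX : ClassX11a W p)
    (hμ : haveI : NeZero p := ⟨(Fact.out : p.Prime).ne_zero⟩
      ∀ κL : ZpExtension (W.divisionField p) p, κL.IsCyclotomic → ClassicalMuVanishes κL) :
    ConjAAt W p := by
  intro κ hκ
  exact hCS W p hX.ne_two hμ κ hκ

end Summit.BirchSwinnertonDyer.BirchSwinnertonDyer.Theorems.UpperNonSurjThreeConjADoors

end
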